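import Literature.Barriers.SmoothPoincare4.WeaklyReducibleGenusThreeStandard
import Literature.Topology.FourManifolds.TrisectionShrink
import Literature.Topology.FourManifolds.WeaklyReducibleTrisectionsNaturality
import Literature.Topology.FourManifolds.ReducibleTrisectionSplittingUniv
import HarnessLib

/-!
# Aranda–Zupan's fact: universe bookkeeping (PROVED) — the three vendorings are ONE statement

Barrier catalogue `Literature/Barriers/SmoothPoincare4/`, proofs companion of
`WeaklyReducibleGenusThreeStandard.lean` (the named fact
`az2025_weaklyReducible_genusThree_homotopySphere_gk`, Aranda–Zupan 2025 Thm. 1.3 for homotopy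
4-spheres; NOT discharged — see that file's "Proof status" and "Review of the statement").

The fact, like its siblings `msz_homotopySphere_gk` / `mz_genus_le_two_homotopySphere_gk`
(`LowGenusTrisectionsStandard.lean`) and its topic twin
`Literature.Topology.FourManifolds.arandaZupan_genus_three_weaklyReducible_homotopySphere_gk`, is
universe polymorphic: it quantifies over closed smooth 4-manifolds `X : Type u`, and the
trisection predicate `Literature.Topology.FourManifolds.IsGKTrisection X 3 k S` carries its model
pieces `W ≅ Z_k`, `H ≅ H_3` as witnesses in the universe of `X`.  A discharge
`theorem …_holds : az2025_…` must therefore hold at EVERY universe, while the concrete models any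
proof ends in (`S⁴`, `S¹ × S³`, spun lens spaces, the manifolds built from diagrams) live in
`Type 0`, and so does the route-shaped vendoring
`Literature.Topology.FourManifolds.arandaZupan_weaklyReducible_genusThree_homotopySphere`
(`WeaklyReducibleGenusThreeTrisections.lean`), for which so far only
`az2025_…_iff_routeShape : az2025_….{0} ↔ …` was proved.  This file closes the gap:

* `az2025_weaklyReducible_genusThree_homotopySphere_gk_of_univ` — **the fact at any one universe
  `v` implies it at every universe `u`** (PROVED).  Given `X : Type u`, a closed smooth
  4-manifold is second countable and Hausdorff, hence `v`-small
  (`Literature.Topology.FourManifolds.small_of_secondCountableTopology`); its copy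
  `Shrink.{v} X : Type v` carries the transported smooth structure and is diffeomorphic to `X`
  (`ManifoldShrink.lean`: `ManifoldShrink.diffeomorph`, orientation `ManifoldShrink.orientation`);
  the trisection moves along this diffeomorphism WITH ITS PIECES shrunk
  (`IsGKTrisection.preimage_diffeomorph`, `TrisectionShrink.lean`), the weak reduction moves
  with it (`Trisection.IsWeaklyReducible.image_diffeomorph`,
  `WeaklyReducibleTrisectionsNaturality.lean`), the homotopy equivalence with `S⁴` is composed
  with the diffeomorphism, and the conclusion `Shrink X ≅ S⁴` is pulled back.
* `az2025_weaklyReducible_genusThree_homotopySphere_gk_univ_iff` — hence `az2025_….{u} ↔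
  az2025_….{v}` for all `u v`; with the dedup record of the main file,
  `az2025_…_iff_topic_univ : az2025_….{u} ↔ arandaZupan_genus_three_….{v}` and
  `az2025_…_iff_routeShape_univ : az2025_….{u} ↔ arandaZupan_weaklyReducible_genusThree_…` for
  EVERY `u` (`az2025_…_of_routeShape`, `arandaZupan_topic_of_routeShape`): the three vendorings
  `{A, B, C}` of Aranda–Zupan's corollary are now PROVABLY one debt node — discharging any one,
  at any one universe (in particular the `Type 0` route shape), discharges all of them at all
  universes.
* `msz_homotopySphere_gk_of_univ`, `msz_homotopySphere_gk_univ_iff`,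
  `mz_genus_le_two_homotopySphere_gk_of_univ`, `mz_genus_le_two_homotopySphere_gk_univ_iff` — the
  same bookkeeping for the two sibling facts of `LowGenusTrisectionsStandard.lean`
  (Meier–Schirmer–Zupan Thm. 1.2 / Meier–Zupan, homotopy-sphere forms), on which the main file's
  reductions `az2025_…_of_msz_of_balanced`, `…_of_msz_of_splitting_of_irreducible` depend
  (the two splitting facts of `ReducibleTrisectionSplitting.lean` get theirs in
  `ReducibleTrisectionSplittingUniv.lean`).
* `az2025_irreducibleCore_of_univ` and
  `az2025_weaklyReducible_genusThree_homotopySphere_gk_of_facts_zero_of_irreducible_zero` —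
  **where the fact stands, universe-free**: Aranda–Zupan's irreducible five-chain core (the
  inline hypothesis `hirr` of the main file's reductions, deliberately NOT a named fact) is
  itself universe-free, so the fact at EVERY universe follows from `Type 0` data only:
  `msz_homotopySphere_gk.{0}`, the two splitting facts at `.{0}`, and the core for `X : Type`.
  A future discharge may therefore build all its manifolds in `Type`.
* `nonempty_diffeomorph_sphere_of_reducing_separating_genusThree_of_fact`,
  `nonempty_diffeomorph_sphere_of_isReducible_genusThree_of_separates`,
  `az2025_weaklyReducible_genusThree_homotopySphere_gk_of_msz_of_sep_of_pi1_of_irreducible`,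
  `not_simplyConnectedSpace_of_reducing_nonseparating_of_univ` and
  `az2025_weaklyReducible_genusThree_homotopySphere_gk_of_facts_zero_of_pi1_zero_of_irreducible_zero`
  — **the reducible branch WITHOUT the non-separating splitting fact.**  Of
  `Trisection.isConnectedSum_circleProd_of_reducing_nonseparating` (frozen as a record in
  `ReducibleTrisectionSplitting.lean`, § Review: mis-cut, to be retired) the main file's
  reductions use only the `π₁`-shadow "a GK-trisected closed 4-manifold with a non-separating
  reducing curve is not simply connected", whose road in the tree now ends at
  `IsGKTrisection.not_simplyConnectedSpace_of_sideCharts`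
  (`ReducibleTrisectionNonSeparatingPi1Charts.lean`).  Here the SEPARATING case is proved from
  `Trisection.isConnectedSum_of_reducing_separating` and the genus-`≤ 2` fact alone, and the
  shadow enters the assembly as an inline hypothesis in the exact binder shape of
  `Trisection.not_simplyConnectedSpace_of_reducing_nonseparating_of_fact` minus its fact argument
  (so the forthcoming theorem, or any variant with fewer hypotheses, is fed in by `fun … => …`);
  the shadow is universe-free like everything else, so again `Type 0` data suffice.  The older
  `…_of_msz_of_splitting_of_irreducible` is recovered from the new assembly (an `example`).

Nothing here introduces a named fact; everything is proved (net debt delta `0`).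

## References

* R. Aranda, A. Zupan, *Manifolds with weakly reducible genus-three trisections are standard*,
  arXiv:2503.04607 (2025), Thm. 1.3 (p. 2), §2 (p. 6). [ArandaZupan2025]
* J. Meier, T. Schirmer, A. Zupan, *Classification of trisections and the Generalized Property R
  Conjecture*, Proc. AMS 144 (2016), Thm. 1.2. [MeierSchirmerZupan2016]
* J. Meier, A. Zupan, *Genus-two trisections are standard*, Geom. Topol. 21 (2017), Thm. 1.2.
  [MeierZupan2017]
* D. Gay, R. Kirby, *Trisecting 4-manifolds*, Geom. Topol. 20 (2016), Def. 1. [GayKirby2016]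
-/

noncomputable section

open scoped Manifold ContDiff
open Set ContinuousMap

namespace Literature.Barriers.SmoothPoincare4

universe u v

open Literature.Topology.FourManifolds Literature.Topology.FourManifolds.Trisection

/-! ### The sibling facts of `LowGenusTrisectionsStandard.lean` across universes -/

/-- **Meier–Schirmer–Zupan's homotopy-sphere fact at one universe gives it at every universe**
(PROVED): move a `(g; k)`-trisected closed smooth `X ≃ₕ S⁴` in `Type u` to its small copy
`Shrink.{v} X` (transported smooth structure and orientation, `ManifoldShrink.lean`; the
trisection with its pieces shrunk, `IsGKTrisection.preimage_diffeomorph`), apply the fact there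
and pull the diffeomorphism with `S⁴` back. [cite: MeierSchirmerZupan2016, Thm. 1.2] -/
theorem msz_homotopySphere_gk_of_univ (h : msz_homotopySphere_gk.{v}) :
    msz_homotopySphere_gk.{u} := by
  intro X _ _ _ _ _ _ _ o g k S hT hk e
  haveI : Small.{v} X := small_of_secondCountableTopology X
  let ψ : Shrink.{v} X ≃ₘ⟮𝓡 4, 𝓡 4⟯ X := ManifoldShrink.diffeomorph (𝓡 4) X ∞
  have hT' : IsGKTrisection (Shrink.{v} X) g k (fun i => ψ.symm '' S i) := by
    simpa only [Diffeomorph.symm_image_eq_preimage] using hT.preimage_diffeomorph ψ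
  obtain ⟨f⟩ := h (Shrink.{v} X) (ManifoldShrink.orientation o) g k _ hT' hk
    (ψ.toHomeomorph.toHomotopyEquiv.trans e)
  exact ⟨ψ.symm.trans f⟩

/-- `msz_homotopySphere_gk` does not depend on the universe. [cite: MeierSchirmerZupan2016, Thm. 1.2] -/
theorem msz_homotopySphere_gk_univ_iff : msz_homotopySphere_gk.{u} ↔ msz_homotopySphere_gk.{v} :=
  ⟨msz_homotopySphere_gk_of_univ, msz_homotopySphere_gk_of_univ⟩

/-- **The Meier–Zupan-range fact at one universe gives it at every universe** (PROVED, same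
transport). [cite: MeierZupan2017, Thm. 1.2] [cite: MeierSchirmerZupan2016, Thm. 1.2] -/
theorem mz_genus_le_two_homotopySphere_gk_of_univ (h : mz_genus_le_two_homotopySphere_gk.{v}) :
    mz_genus_le_two_homotopySphere_gk.{u} := by
  intro X _ _ _ _ _ _ _ o g k S hT hg e
  haveI : Small.{v} X := small_of_secondCountableTopology X
  let ψ : Shrink.{v} X ≃ₘ⟮𝓡 4, 𝓡 4⟯ X := ManifoldShrink.diffeomorph (𝓡 4) X ∞
  have hT' : IsGKTrisection (Shrink.{v} X) g k (fun i => ψ.symm '' S i) := by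
    simpa only [Diffeomorph.symm_image_eq_preimage] using hT.preimage_diffeomorph ψ
  obtain ⟨f⟩ := h (Shrink.{v} X) (ManifoldShrink.orientation o) g k _ hT' hg
    (ψ.toHomeomorph.toHomotopyEquiv.trans e)
  exact ⟨ψ.symm.trans f⟩

/-- `mz_genus_le_two_homotopySphere_gk` does not depend on the universe. [cite: MeierZupan2017, Thm. 1.2] -/
theorem mz_genus_le_two_homotopySphere_gk_univ_iff :
    mz_genus_le_two_homotopySphere_gk.{u} ↔ mz_genus_le_two_homotopySphere_gk.{v} :=
  ⟨mz_genus_le_two_homotopySphere_gk_of_univ, mz_genus_le_two_homotopySphere_gk_of_univ⟩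

/-! ### Aranda–Zupan's fact across universes; the three vendorings are one statement -/

/-- **Aranda–Zupan's homotopy-sphere fact at one universe gives it at every universe**
(PROVED).  Given a weakly reducible `(3; k)`-trisected closed connected oriented smooth
`X ≃ₕ S⁴` in `Type u`: `X` is `v`-small (second countable Hausdorff,
`small_of_secondCountableTopology`), its copy `Shrink.{v} X : Type v` carries the transported
smooth structure and orientation and a diffeomorphism `ψ : Shrink X ≅ X` (`ManifoldShrink.lean`),
the trisection moves to `Shrink X` with its pieces shrunk (`IsGKTrisection.preimage_diffeomorph`),
the weak reduction moves with it (`Trisection.IsWeaklyReducible.image_diffeomorph`), and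
`Shrink X ≃ₕ S⁴` through `ψ`; the fact at universe `v` gives `Shrink X ≅ S⁴`, whence
`X ≅ S⁴` through `ψ⁻¹`. [cite: ArandaZupan2025, Thm. 1.3 (p. 2) and §2 (p. 6)] -/
theorem az2025_weaklyReducible_genusThree_homotopySphere_gk_of_univ
    (h : az2025_weaklyReducible_genusThree_homotopySphere_gk.{v}) :
    az2025_weaklyReducible_genusThree_homotopySphere_gk.{u} := by
  intro X _ _ _ _ _ _ _ o k S hT hwr e
  haveI : Small.{v} X := small_of_secondCountableTopology X
  let ψ : Shrink.{v} X ≃ₘ⟮𝓡 4, 𝓡 4⟯ X := ManifoldShrink.diffeomorph (𝓡 4) X ∞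
  have hT' : IsGKTrisection (Shrink.{v} X) 3 k (fun i => ψ.symm '' S i) := by
    simpa only [Diffeomorph.symm_image_eq_preimage] using hT.preimage_diffeomorph ψ
  have hwr' : IsWeaklyReducible (fun i => ψ.symm '' S i) :=
    (show IsWeaklyReducible S from hwr).image_diffeomorph ψ.symm
  obtain ⟨f⟩ := h (Shrink.{v} X) (ManifoldShrink.orientation o) k _ hT' hwr'
    (ψ.toHomeomorph.toHomotopyEquiv.trans e)
  exact ⟨ψ.symm.trans f⟩

/-- **Aranda–Zupan's fact does not depend on the universe.** [cite: ArandaZupan2025, Thm. 1.3 (p. 2)] -/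
theorem az2025_weaklyReducible_genusThree_homotopySphere_gk_univ_iff :
    az2025_weaklyReducible_genusThree_homotopySphere_gk.{u} ↔
      az2025_weaklyReducible_genusThree_homotopySphere_gk.{v} :=
  ⟨az2025_weaklyReducible_genusThree_homotopySphere_gk_of_univ,
    az2025_weaklyReducible_genusThree_homotopySphere_gk_of_univ⟩

/-- **Dedup record, universe-free form (PROVED): this fact at any universe `u` is equivalent to
the topic fact `Literature.Topology.FourManifolds.arandaZupan_genus_three_weaklyReducible_homotopySphere_gk`
at any universe `v`** (`WeaklyReducibleTrisections.lean`; definitionally equal universe-wise,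
`az2025_…_iff_topic`, plus `…_univ_iff`). [cite: ArandaZupan2025, Thm. 1.3 (p. 2)] -/
theorem az2025_weaklyReducible_genusThree_homotopySphere_gk_iff_topic_univ :
    az2025_weaklyReducible_genusThree_homotopySphere_gk.{u} ↔
      Literature.Topology.FourManifolds.arandaZupan_genus_three_weaklyReducible_homotopySphere_gk.{v} :=
  az2025_weaklyReducible_genusThree_homotopySphere_gk_univ_iff.{u, v}.trans
    az2025_weaklyReducible_genusThree_homotopySphere_gk_iff_topic

/-- **Dedup record, universe-free form (PROVED): this fact at ANY universe `u` is equivalent to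
the route-shaped `Type 0` vendoring
`Literature.Topology.FourManifolds.arandaZupan_weaklyReducible_genusThree_homotopySphere`**
(`WeaklyReducibleGenusThreeTrisections.lean`, verbatim the route item `GenusThreeBase`) — so far
known only at `u = 0` (`az2025_…_iff_routeShape`). [cite: ArandaZupan2025, Thm. 1.3 (p. 2)] -/
theorem az2025_weaklyReducible_genusThree_homotopySphere_gk_iff_routeShape_univ :
    az2025_weaklyReducible_genusThree_homotopySphere_gk.{u} ↔
      Literature.Topology.FourManifolds.arandaZupan_weaklyReducible_genusThree_homotopySphere :=
  az2025_weaklyReducible_genusThree_homotopySphere_gk_univ_iff.{u, 0}.trans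
    az2025_weaklyReducible_genusThree_homotopySphere_gk_iff_routeShape

/-- Hence a proof of the route-shaped `Type 0` statement discharges this fact at every universe.
[cite: ArandaZupan2025, Thm. 1.3 (p. 2)] -/
theorem az2025_weaklyReducible_genusThree_homotopySphere_gk_of_routeShape
    (h : Literature.Topology.FourManifolds.arandaZupan_weaklyReducible_genusThree_homotopySphere) :
    az2025_weaklyReducible_genusThree_homotopySphere_gk.{u} :=
  az2025_weaklyReducible_genusThree_homotopySphere_gk_iff_routeShape_univ.mpr h

/-- … and the topic fact at every universe (closing the triangle `C → B.{u}`; the main file has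
`B.{0} → C`, `arandaZupan_routeShape_of_topic`). [cite: ArandaZupan2025, Thm. 1.3 (p. 2)] -/
theorem arandaZupan_topic_of_routeShape
    (h : Literature.Topology.FourManifolds.arandaZupan_weaklyReducible_genusThree_homotopySphere) :
    Literature.Topology.FourManifolds.arandaZupan_genus_three_weaklyReducible_homotopySphere_gk.{u} :=
  az2025_weaklyReducible_genusThree_homotopySphere_gk_iff_topic_univ.{u, u}.mp
    (az2025_weaklyReducible_genusThree_homotopySphere_gk_of_routeShape.{u} h)

/-! ### The irreducible core across universes; the fact from `Type 0` data -/

section Core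

variable {X : Type u} [TopologicalSpace X] [ChartedSpace (EuclideanSpace ℝ (Fin 4)) X]
  [IsManifold (𝓡 4) ∞ X]
  {X' : Type v} [TopologicalSpace X'] [ChartedSpace (EuclideanSpace ℝ (Fin 4)) X']
  [IsManifold (𝓡 4) ∞ X']

/-- **A weak reduction with the labels fixed moves along a diffeomorphism** (`c` compressing in
`H_0`, `c′` in `H_1` and `H_2`, for the image sectors): curves, disjointness, non-separation and
compressing discs are natural (`WeaklyReducibleTrisectionsNaturality.lean`) and
`H_p(Φ '' S) = Φ '' H_p(S)`. [cite: ArandaZupan2025, §2 (p. 6)] -/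
theorem fixedLabels_weakReduction_image_diffeomorph {S : Fin 3 → Set X}
    (hwr : ∃ c c' : Set X, IsCurve S c ∧ IsCurve S c' ∧ Disjoint c c' ∧
      IsNonSeparating S c ∧ IsNonSeparating S c' ∧
      BoundsDisc S (spineHandlebody S 0) c ∧ BoundsDisc S (spineHandlebody S 1) c' ∧
      BoundsDisc S (spineHandlebody S 2) c')
    (Φ : X ≃ₘ⟮𝓡 4, 𝓡 4⟯ X') :
    ∃ c c' : Set X', IsCurve (fun i => Φ '' S i) c ∧ IsCurve (fun i => Φ '' S i) c' ∧
      Disjoint c c' ∧ IsNonSeparating (fun i => Φ '' S i) c ∧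
      IsNonSeparating (fun i => Φ '' S i) c' ∧
      BoundsDisc (fun i => Φ '' S i) (spineHandlebody (fun i => Φ '' S i) 0) c ∧
      BoundsDisc (fun i => Φ '' S i) (spineHandlebody (fun i => Φ '' S i) 1) c' ∧
      BoundsDisc (fun i => Φ '' S i) (spineHandlebody (fun i => Φ '' S i) 2) c' := by
  obtain ⟨c, c', hc, hc', hd, hn, hn', hb0, hb1, hb2⟩ := hwr
  have hinj : Function.Injective Φ := EquivLike.injective Φ
  refine ⟨Φ '' c, Φ '' c', hc.image_diffeomorph Φ, hc'.image_diffeomorph Φ,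
    (disjoint_image_iff hinj).2 hd, hn.image_homeomorph Φ.toHomeomorph,
    hn'.image_homeomorph Φ.toHomeomorph, ?_, ?_, ?_⟩ <;> rw [spineHandlebody_image S hinj]
  · exact hb0.image_diffeomorph Φ
  · exact hb1.image_diffeomorph Φ
  · exact hb2.image_diffeomorph Φ

end Core

/-- **Aranda–Zupan's irreducible core at one universe gives it at every universe** (PROVED):
the outstanding content of the fact — "a closed connected oriented smooth `X ≃ₕ S⁴` with a
balanced `(3; 1,1,1)`-trisection carrying a weak reduction with fixed labels and NO reducing
curve is diffeomorphic to `S⁴`" (Aranda–Zupan's five-chain case; an inline hypothesis shape,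
deliberately not a named fact, D-0026) — moves to the small copy `Shrink.{v} X` like everything
else (balanced trisection: `IsGKTrisection.preimage_diffeomorph`; fixed-label weak reduction:
`fixedLabels_weakReduction_image_diffeomorph`; irreducibility:
`Trisection.isReducible_image_diffeomorph_iff`). [cite: ArandaZupan2025, Thm. 1.3 (p. 2), §6 (pp. 20–24), Prop. 5.5] -/
theorem az2025_irreducibleCore_of_univ
    (hirr : ∀ (X : Type v) [TopologicalSpace X] [T2Space X] [SecondCountableTopology X]
      [ChartedSpace (EuclideanSpace ℝ (Fin 4)) X] [IsManifold (𝓡 4) ∞ X] [CompactSpace X]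
      [ConnectedSpace X] (_ : SmoothOrientation (𝓡 4) X) (S : Fin 3 → Set X),
      IsBalancedGKTrisection X 3 1 S →
      (∃ c c' : Set X, IsCurve S c ∧ IsCurve S c' ∧ Disjoint c c' ∧
        IsNonSeparating S c ∧ IsNonSeparating S c' ∧
        BoundsDisc S (spineHandlebody S 0) c ∧ BoundsDisc S (spineHandlebody S 1) c' ∧
        BoundsDisc S (spineHandlebody S 2) c') →
      ¬ IsReducible S → X ≃ₕ (Metric.sphere (0 : EuclideanSpace ℝ (Fin (4 + 1))) 1) →
        Nonempty (X ≃ₘ⟮𝓡 4, 𝓡 4⟯ (Metric.sphere (0 : EuclideanSpace ℝ (Fin (4 + 1))) 1)))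
    (X : Type u) [TopologicalSpace X] [T2Space X] [SecondCountableTopology X]
    [ChartedSpace (EuclideanSpace ℝ (Fin 4)) X] [IsManifold (𝓡 4) ∞ X] [CompactSpace X]
    [ConnectedSpace X] (o : SmoothOrientation (𝓡 4) X) (S : Fin 3 → Set X)
    (hT : IsBalancedGKTrisection X 3 1 S)
    (hwr : ∃ c c' : Set X, IsCurve S c ∧ IsCurve S c' ∧ Disjoint c c' ∧
      IsNonSeparating S c ∧ IsNonSeparating S c' ∧
      BoundsDisc S (spineHandlebody S 0) c ∧ BoundsDisc S (spineHandlebody S 1) c' ∧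
      BoundsDisc S (spineHandlebody S 2) c')
    (hnr : ¬ IsReducible S) (e : X ≃ₕ (Metric.sphere (0 : EuclideanSpace ℝ (Fin (4 + 1))) 1)) :
    Nonempty (X ≃ₘ⟮𝓡 4, 𝓡 4⟯ (Metric.sphere (0 : EuclideanSpace ℝ (Fin (4 + 1))) 1)) := by
  haveI : Small.{v} X := small_of_secondCountableTopology X
  let ψ : Shrink.{v} X ≃ₘ⟮𝓡 4, 𝓡 4⟯ X := ManifoldShrink.diffeomorph (𝓡 4) X ∞
  have hT' : IsBalancedGKTrisection (Shrink.{v} X) 3 1 (fun i => ψ.symm '' S i) := by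
    simpa only [Diffeomorph.symm_image_eq_preimage] using hT.preimage_diffeomorph ψ
  have hnr' : ¬ IsReducible (fun i => ψ.symm '' S i) := fun h' =>
    hnr ((isReducible_image_diffeomorph_iff S ψ.symm).1 h')
  obtain ⟨f⟩ := hirr (Shrink.{v} X) (ManifoldShrink.orientation o) _ hT'
    (fixedLabels_weakReduction_image_diffeomorph hwr ψ.symm) hnr'
    (ψ.toHomeomorph.toHomotopyEquiv.trans e)
  exact ⟨ψ.symm.trans f⟩

/-- **Where the fact stands, universe-free (PROVED glue): `Type 0` data suffice.**  GIVEN, at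
universe `0` ONLY, Meier–Schirmer–Zupan's fact (`hMSZ₀`), the two splitting facts for reducible
trisections (`hsep₀`, `hns₀`, Aranda–Zupan §2 p. 6) and Aranda–Zupan's irreducible core
(`hirr₀`: the five-chain case, Prop. 3.9, §§4–6 — the one input with no counterpart in the tree,
NOT restated as a named fact), the fact holds at EVERY universe `u`: each input is universe-free
(`msz_homotopySphere_gk_of_univ`, `Trisection.isConnectedSum_of_reducing_separating_of_univ`,
`Trisection.isConnectedSum_circleProd_of_reducing_nonseparating_of_univ`,
`az2025_irreducibleCore_of_univ`) and the main file's reduction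
`az2025_weaklyReducible_genusThree_homotopySphere_gk_of_msz_of_splitting_of_irreducible`
assembles them.  So a future discharge may build everything with `X : Type`.
[cite: ArandaZupan2025, Thm. 1.3 (p. 2), §6 (pp. 20–24), Prop. 5.5] [cite: MeierSchirmerZupan2016, Thm. 1.2] -/
theorem az2025_weaklyReducible_genusThree_homotopySphere_gk_of_facts_zero_of_irreducible_zero
    (hMSZ₀ : msz_homotopySphere_gk.{0})
    (hsep₀ : isConnectedSum_of_reducing_separating.{0})
    (hns₀ : isConnectedSum_circleProd_of_reducing_nonseparating.{0})
    (hirr₀ : ∀ (X : Type) [TopologicalSpace X] [T2Space X] [SecondCountableTopology X]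
      [ChartedSpace (EuclideanSpace ℝ (Fin 4)) X] [IsManifold (𝓡 4) ∞ X] [CompactSpace X]
      [ConnectedSpace X] (_ : SmoothOrientation (𝓡 4) X) (S : Fin 3 → Set X),
      IsBalancedGKTrisection X 3 1 S →
      (∃ c c' : Set X, IsCurve S c ∧ IsCurve S c' ∧ Disjoint c c' ∧
        IsNonSeparating S c ∧ IsNonSeparating S c' ∧
        BoundsDisc S (spineHandlebody S 0) c ∧ BoundsDisc S (spineHandlebody S 1) c' ∧
        BoundsDisc S (spineHandlebody S 2) c') →
      ¬ IsReducible S → X ≃ₕ (Metric.sphere (0 : EuclideanSpace ℝ (Fin (4 + 1))) 1) →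
        Nonempty (X ≃ₘ⟮𝓡 4, 𝓡 4⟯ (Metric.sphere (0 : EuclideanSpace ℝ (Fin (4 + 1))) 1))) :
    az2025_weaklyReducible_genusThree_homotopySphere_gk.{u} :=
  az2025_weaklyReducible_genusThree_homotopySphere_gk_of_msz_of_splitting_of_irreducible
    (msz_homotopySphere_gk_of_univ hMSZ₀) (isConnectedSum_of_reducing_separating_of_univ hsep₀)
    (isConnectedSum_circleProd_of_reducing_nonseparating_of_univ hns₀)
    (fun X _ _ _ _ _ _ _ o S hT hwr hnr e => az2025_irreducibleCore_of_univ hirr₀ X o S hT hwr hnr e)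

/-! ### The reducible branch without the non-separating splitting fact

Of the frozen record `Trisection.isConnectedSum_circleProd_of_reducing_nonseparating` the
reductions of the main file use only its `π₁`-shadow (a non-separating reducing curve forces
`π₁(X) ≠ 1`).  The separating case needs no shadow at all; the assembly takes the shadow as an
inline hypothesis in the binder shape of
`Trisection.not_simplyConnectedSpace_of_reducing_nonseparating_of_fact` (minus the fact). -/

section PiOneShadow

/-- **A SEPARATING reducing curve on a genus-`3` trisection of a homotopy 4-sphere makes it
`S⁴`** (PROVED glue, GIVEN the separating splitting fact and the genus-`≤ 2` fact only): the
fact writes `X = X₁ # X₂` with trisections of genera `g₁ + g₂ = 3`, `gᵢ ≥ 1`, so `gᵢ ≤ 2`; the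
summands are homotopy 4-spheres (Kosinski VI.2.1, discharged in the tree:
`nonempty_homotopyEquiv_sphere_four_left_of_isConnectedSum_holds`), oriented by
`isOrientable_of_homotopyEquiv_sphere_four_holds`, hence `≅ S⁴` by the genus-`≤ 2` fact, and
`S⁴ # S⁴ ≅ S⁴` (`connectedSum_sphere_sphere_holds`).  First paragraph of the printed proof of
Thm. 1.3 (§6 p. 20), separating case, for homotopy spheres.
[cite: ArandaZupan2025, §6 (p. 20, reducible case) and §2 (p. 6)] [cite: Kosinski1993, Ch. VI §2, Prop. 2.1] [cite: MeierZupan2017, Thm. 1.2] -/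
theorem nonempty_diffeomorph_sphere_of_reducing_separating_genusThree_of_fact
    (hsep : isConnectedSum_of_reducing_separating.{u})
    (hMZ : mz_genus_le_two_homotopySphere_gk.{u})
    (X : Type u) [TopologicalSpace X] [T2Space X] [SecondCountableTopology X]
    [ChartedSpace (EuclideanSpace ℝ (Fin 4)) X] [IsManifold (𝓡 4) ∞ X] [CompactSpace X]
    [ConnectedSpace X] (o : SmoothOrientation (𝓡 4) X) (k : Fin 3 → ℕ) (S : Fin 3 → Set X)
    (hT : IsGKTrisection X 3 k S) {δ : Set X} (hc : IsCurve S δ)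
    (hess : ¬ ∃ e : Metric.closedBall (0 : EuclideanSpace ℝ (Fin 2)) 1 → X,
      Manifold.IsSmoothEmbedding (𝓡∂ 2) (𝓡 4) ∞ e ∧ range e ⊆ centralSurfaceSet S ∧
        e '' (𝓡∂ 2).boundary (Metric.closedBall (0 : EuclideanSpace ℝ (Fin 2)) 1) = δ)
    (hd : ∀ q : Fin 3, BoundsDisc S (spineHandlebody S q) δ) (hn : ¬ IsNonSeparating S δ)
    (e : X ≃ₕ (Metric.sphere (0 : EuclideanSpace ℝ (Fin (4 + 1))) 1)) :
    Nonempty (X ≃ₘ⟮𝓡 4, 𝓡 4⟯ (Metric.sphere (0 : EuclideanSpace ℝ (Fin (4 + 1))) 1)) := by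
  obtain ⟨X₁, _, _, _, _, _, _, _, X₂, _, _, _, _, _, _, _, g₁, g₂, k₁, k₂, S₁, S₂, hT₁, hT₂,
    hg, hg₁, hg₂, -, hP⟩ := hsep X o 3 k S δ hT hc hess hd hn
  obtain ⟨e₁⟩ := nonempty_homotopyEquiv_sphere_four_left_of_isConnectedSum_holds X₁ X₂ X hP e
  obtain ⟨e₂⟩ :=
    nonempty_homotopyEquiv_sphere_four_left_of_isConnectedSum_holds X₂ X₁ X hP.symm e
  obtain ⟨o₁⟩ := isOrientable_of_homotopyEquiv_sphere_four_holds X₁ e₁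
  obtain ⟨o₂⟩ := isOrientable_of_homotopyEquiv_sphere_four_holds X₂ e₂
  have h₁ : Nonempty (X₁ ≃ₘ⟮𝓡 4, 𝓡 4⟯ (Metric.sphere (0 : EuclideanSpace ℝ (Fin (4 + 1))) 1)) :=
    hMZ X₁ o₁ g₁ k₁ S₁ hT₁ (by omega) e₁
  have h₂ : Nonempty (X₂ ≃ₘ⟮𝓡 4, 𝓡 4⟯ (Metric.sphere (0 : EuclideanSpace ℝ (Fin (4 + 1))) 1)) :=
    hMZ X₂ o₂ g₂ k₂ S₂ hT₂ (by omega) e₂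
  exact connectedSum_sphere_sphere_holds 4 (by norm_num) X₁ X₂ X hP h₁ h₂

/-- **The reducible branch for homotopy 4-spheres, GIVEN the separating splitting fact, the
genus-`≤ 2` fact, and that every reducing curve of THIS trisection separates** (PROVED glue).
The last hypothesis is what the `π₁`-shadow of the non-separating case yields on a simply
connected `X`; it replaces the record `Trisection.isConnectedSum_circleProd_of_reducing_nonseparating`
of `nonempty_diffeomorph_sphere_of_isReducible_genusThree_of_splitting`.
[cite: ArandaZupan2025, §6 (p. 20, reducible case) and §2 (p. 6)] [cite: MeierZupan2017, Thm. 1.2] -/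
theorem nonempty_diffeomorph_sphere_of_isReducible_genusThree_of_separates
    (hsep : isConnectedSum_of_reducing_separating.{u})
    (hMZ : mz_genus_le_two_homotopySphere_gk.{u})
    (X : Type u) [TopologicalSpace X] [T2Space X] [SecondCountableTopology X]
    [ChartedSpace (EuclideanSpace ℝ (Fin 4)) X] [IsManifold (𝓡 4) ∞ X] [CompactSpace X]
    [ConnectedSpace X] (o : SmoothOrientation (𝓡 4) X) (k : Fin 3 → ℕ) (S : Fin 3 → Set X)
    (hT : IsGKTrisection X 3 k S) (hred : IsReducible S)
    (hπ : ∀ δ : Set X, IsCurve S δ →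
      (¬ ∃ e : Metric.closedBall (0 : EuclideanSpace ℝ (Fin 2)) 1 → X,
        Manifold.IsSmoothEmbedding (𝓡∂ 2) (𝓡 4) ∞ e ∧ range e ⊆ centralSurfaceSet S ∧
          e '' (𝓡∂ 2).boundary (Metric.closedBall (0 : EuclideanSpace ℝ (Fin 2)) 1) = δ) →
      (∀ q : Fin 3, BoundsDisc S (spineHandlebody S q) δ) → ¬ IsNonSeparating S δ)
    (e : X ≃ₕ (Metric.sphere (0 : EuclideanSpace ℝ (Fin (4 + 1))) 1)) :
    Nonempty (X ≃ₘ⟮𝓡 4, 𝓡 4⟯ (Metric.sphere (0 : EuclideanSpace ℝ (Fin (4 + 1))) 1)) := by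
  obtain ⟨δ, hc, hess, hd⟩ := hred
  exact nonempty_diffeomorph_sphere_of_reducing_separating_genusThree_of_fact hsep hMZ X o k S hT
    hc hess hd (hπ δ hc hess hd) e

/-- **Where the fact stands, with the non-separating record replaced by its `π₁`-shadow**
(PROVED glue).  GIVEN `msz_homotopySphere_gk` (Meier–Schirmer–Zupan, homotopy-sphere form),
the SEPARATING splitting fact `Trisection.isConnectedSum_of_reducing_separating`, the
`π₁`-shadow of the non-separating case as an inline hypothesis `hπ` — "a closed connected
oriented GK-trisected 4-manifold with a non-separating reducing curve is not simply connected",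
in the binder shape of `Trisection.not_simplyConnectedSpace_of_reducing_nonseparating_of_fact`
without its fact argument, so that the forthcoming theorem of
`ReducibleTrisectionNonSeparatingPi1Charts.lean`'s programme (or any variant with fewer
hypotheses) is fed in by `fun … => …` — and Aranda–Zupan's irreducible five-chain core `hirr`,
the fact holds.  On a homotopy sphere `hπ` says that every reducing curve separates, and the
reducible branch is `nonempty_diffeomorph_sphere_of_isReducible_genusThree_of_separates`.
[cite: ArandaZupan2025, Thm. 1.3 (p. 2), §6 (pp. 20–24), §2 (p. 6), Prop. 5.5] [cite: MeierSchirmerZupan2016, Thm. 1.2] -/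
theorem az2025_weaklyReducible_genusThree_homotopySphere_gk_of_msz_of_sep_of_pi1_of_irreducible
    (hMSZ : msz_homotopySphere_gk.{u})
    (hsep : isConnectedSum_of_reducing_separating.{u})
    (hπ : ∀ (X : Type u) [TopologicalSpace X] [T2Space X] [SecondCountableTopology X]
      [ChartedSpace (EuclideanSpace ℝ (Fin 4)) X] [IsManifold (𝓡 4) ∞ X] [CompactSpace X]
      [ConnectedSpace X] (_ : SmoothOrientation (𝓡 4) X) (g : ℕ) (k : Fin 3 → ℕ)
      (S : Fin 3 → Set X) (δ : Set X), IsGKTrisection X g k S → IsCurve S δ →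
      (¬ ∃ e : Metric.closedBall (0 : EuclideanSpace ℝ (Fin 2)) 1 → X,
        Manifold.IsSmoothEmbedding (𝓡∂ 2) (𝓡 4) ∞ e ∧ range e ⊆ centralSurfaceSet S ∧
          e '' (𝓡∂ 2).boundary (Metric.closedBall (0 : EuclideanSpace ℝ (Fin 2)) 1) = δ) →
      (∀ q : Fin 3, BoundsDisc S (spineHandlebody S q) δ) → IsNonSeparating S δ →
      ¬ SimplyConnectedSpace X)
    (hirr : ∀ (X : Type u) [TopologicalSpace X] [T2Space X] [SecondCountableTopology X]
      [ChartedSpace (EuclideanSpace ℝ (Fin 4)) X] [IsManifold (𝓡 4) ∞ X] [CompactSpace X]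
      [ConnectedSpace X] (_ : SmoothOrientation (𝓡 4) X) (S : Fin 3 → Set X),
      IsBalancedGKTrisection X 3 1 S →
      (∃ c c' : Set X, IsCurve S c ∧ IsCurve S c' ∧ Disjoint c c' ∧
        IsNonSeparating S c ∧ IsNonSeparating S c' ∧
        BoundsDisc S (spineHandlebody S 0) c ∧ BoundsDisc S (spineHandlebody S 1) c' ∧
        BoundsDisc S (spineHandlebody S 2) c') →
      ¬ IsReducible S → X ≃ₕ (Metric.sphere (0 : EuclideanSpace ℝ (Fin (4 + 1))) 1) →
        Nonempty (X ≃ₘ⟮𝓡 4, 𝓡 4⟯ (Metric.sphere (0 : EuclideanSpace ℝ (Fin (4 + 1))) 1))) :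
    az2025_weaklyReducible_genusThree_homotopySphere_gk.{u} := by
  refine az2025_weaklyReducible_genusThree_homotopySphere_gk_of_msz_of_balanced hMSZ
    fun X _ _ _ _ _ _ _ o S hT hwr e => ?_
  by_cases hred : IsReducible S
  · haveI : SimplyConnectedSpace (Metric.sphere (0 : EuclideanSpace ℝ (Fin (4 + 1))) 1) :=
      simplyConnectedSpace_sphere_four_holds
    haveI : SimplyConnectedSpace X := e.simplyConnectedSpace
    exact nonempty_diffeomorph_sphere_of_isReducible_genusThree_of_separates hsep
      (mz_genus_le_two_homotopySphere_gk_of_msz_alone hMSZ) X o (fun _ => 1) S hT.isGKTrisection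
      hred (fun δ hc hess hd hn => hπ X o 3 (fun _ => 1) S δ hT.isGKTrisection hc hess hd hn ‹_›) e
  · exact hirr X o S hT hwr hred e

/-- The older assembly `…_of_msz_of_splitting_of_irreducible` (non-separating RECORD as input) is
the special case `hπ := Trisection.not_simplyConnectedSpace_of_reducing_nonseparating_of_fact hns`
of the new one. [cite: ArandaZupan2025, §2 (p. 6)] -/
example (hMSZ : msz_homotopySphere_gk.{u})
    (hsep : isConnectedSum_of_reducing_separating.{u})
    (hns : isConnectedSum_circleProd_of_reducing_nonseparating.{u})
    (hirr : ∀ (X : Type u) [TopologicalSpace X] [T2Space X] [SecondCountableTopology X]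
      [ChartedSpace (EuclideanSpace ℝ (Fin 4)) X] [IsManifold (𝓡 4) ∞ X] [CompactSpace X]
      [ConnectedSpace X] (_ : SmoothOrientation (𝓡 4) X) (S : Fin 3 → Set X),
      IsBalancedGKTrisection X 3 1 S →
      (∃ c c' : Set X, IsCurve S c ∧ IsCurve S c' ∧ Disjoint c c' ∧
        IsNonSeparating S c ∧ IsNonSeparating S c' ∧
        BoundsDisc S (spineHandlebody S 0) c ∧ BoundsDisc S (spineHandlebody S 1) c' ∧
        BoundsDisc S (spineHandlebody S 2) c') →
      ¬ IsReducible S → X ≃ₕ (Metric.sphere (0 : EuclideanSpace ℝ (Fin (4 + 1))) 1) →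
        Nonempty (X ≃ₘ⟮𝓡 4, 𝓡 4⟯ (Metric.sphere (0 : EuclideanSpace ℝ (Fin (4 + 1))) 1))) :
    az2025_weaklyReducible_genusThree_homotopySphere_gk.{u} :=
  az2025_weaklyReducible_genusThree_homotopySphere_gk_of_msz_of_sep_of_pi1_of_irreducible hMSZ hsep
    (fun _ _ _ _ _ _ _ _ o _ _ _ _ hT hc hess hd hn =>
      not_simplyConnectedSpace_of_reducing_nonseparating_of_fact hns o hT hc hess hd hn) hirr

/-- **The `π₁`-shadow is universe-free** (PROVED): if at universe `v` every closed connected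
oriented GK-trisected 4-manifold with a non-separating reducing curve fails to be simply
connected, the same holds at universe `u` — move `X : Type u` with its trisection, curve,
essentiality, discs and non-separation to `Shrink.{v} X` (`ManifoldShrink.lean`,
`IsGKTrisection.preimage_diffeomorph`, `WeaklyReducibleTrisectionsNaturality.lean`,
`Trisection.not_exists_disc_image_diffeomorph`); simple connectivity moves along the
homeomorphism. [cite: ArandaZupan2025, §2 (p. 6)] -/
theorem not_simplyConnectedSpace_of_reducing_nonseparating_of_univ
    (h : ∀ (X : Type v) [TopologicalSpace X] [T2Space X] [SecondCountableTopology X]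
      [ChartedSpace (EuclideanSpace ℝ (Fin 4)) X] [IsManifold (𝓡 4) ∞ X] [CompactSpace X]
      [ConnectedSpace X] (_ : SmoothOrientation (𝓡 4) X) (g : ℕ) (k : Fin 3 → ℕ)
      (S : Fin 3 → Set X) (δ : Set X), IsGKTrisection X g k S → IsCurve S δ →
      (¬ ∃ e : Metric.closedBall (0 : EuclideanSpace ℝ (Fin 2)) 1 → X,
        Manifold.IsSmoothEmbedding (𝓡∂ 2) (𝓡 4) ∞ e ∧ range e ⊆ centralSurfaceSet S ∧
          e '' (𝓡∂ 2).boundary (Metric.closedBall (0 : EuclideanSpace ℝ (Fin 2)) 1) = δ) →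
      (∀ q : Fin 3, BoundsDisc S (spineHandlebody S q) δ) → IsNonSeparating S δ →
      ¬ SimplyConnectedSpace X)
    (X : Type u) [TopologicalSpace X] [T2Space X] [SecondCountableTopology X]
    [ChartedSpace (EuclideanSpace ℝ (Fin 4)) X] [IsManifold (𝓡 4) ∞ X] [CompactSpace X]
    [ConnectedSpace X] (o : SmoothOrientation (𝓡 4) X) (g : ℕ) (k : Fin 3 → ℕ)
    (S : Fin 3 → Set X) (δ : Set X) (hT : IsGKTrisection X g k S) (hc : IsCurve S δ)
    (hess : ¬ ∃ e : Metric.closedBall (0 : EuclideanSpace ℝ (Fin 2)) 1 → X,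
      Manifold.IsSmoothEmbedding (𝓡∂ 2) (𝓡 4) ∞ e ∧ range e ⊆ centralSurfaceSet S ∧
        e '' (𝓡∂ 2).boundary (Metric.closedBall (0 : EuclideanSpace ℝ (Fin 2)) 1) = δ)
    (hd : ∀ q : Fin 3, BoundsDisc S (spineHandlebody S q) δ) (hns : IsNonSeparating S δ) :
    ¬ SimplyConnectedSpace X := by
  intro hsc
  haveI := hsc
  haveI : Small.{v} X := small_of_secondCountableTopology X
  let ψ : Shrink.{v} X ≃ₘ⟮𝓡 4, 𝓡 4⟯ X := ManifoldShrink.diffeomorph (𝓡 4) X ∞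
  have hinj : Function.Injective ψ.symm := EquivLike.injective ψ.symm
  have hT' : IsGKTrisection (Shrink.{v} X) g k (fun i => ψ.symm '' S i) := by
    simpa only [Diffeomorph.symm_image_eq_preimage] using hT.preimage_diffeomorph ψ
  have hd' : ∀ q : Fin 3, BoundsDisc (fun i => ψ.symm '' S i)
      (spineHandlebody (fun i => ψ.symm '' S i) q) (ψ.symm '' δ) := fun q => by
    rw [spineHandlebody_image S hinj]
    exact (hd q).image_diffeomorph ψ.symm
  haveI : SimplyConnectedSpace (Shrink.{v} X) :=
    ψ.toHomeomorph.toHomotopyEquiv.simplyConnectedSpace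
  exact h (Shrink.{v} X) (ManifoldShrink.orientation o) g k _ _ hT' (hc.image_diffeomorph ψ.symm)
    (not_exists_disc_image_diffeomorph hess ψ.symm) hd' (hns.image_homeomorph ψ.symm.toHomeomorph)
    ‹_›

/-- **`Type 0` data suffice, shadow form** (PROVED glue): GIVEN, at universe `0` ONLY,
`msz_homotopySphere_gk`, the separating splitting fact, the `π₁`-shadow of the non-separating
case and Aranda–Zupan's irreducible core, the fact holds at EVERY universe (each input is
universe-free: `msz_homotopySphere_gk_of_univ`,
`Trisection.isConnectedSum_of_reducing_separating_of_univ`,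
`not_simplyConnectedSpace_of_reducing_nonseparating_of_univ`, `az2025_irreducibleCore_of_univ`).
[cite: ArandaZupan2025, Thm. 1.3 (p. 2), §6 (pp. 20–24), §2 (p. 6), Prop. 5.5] [cite: MeierSchirmerZupan2016, Thm. 1.2] -/
theorem az2025_weaklyReducible_genusThree_homotopySphere_gk_of_facts_zero_of_pi1_zero_of_irreducible_zero
    (hMSZ₀ : msz_homotopySphere_gk.{0})
    (hsep₀ : isConnectedSum_of_reducing_separating.{0})
    (hπ₀ : ∀ (X : Type) [TopologicalSpace X] [T2Space X] [SecondCountableTopology X]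
      [ChartedSpace (EuclideanSpace ℝ (Fin 4)) X] [IsManifold (𝓡 4) ∞ X] [CompactSpace X]
      [ConnectedSpace X] (_ : SmoothOrientation (𝓡 4) X) (g : ℕ) (k : Fin 3 → ℕ)
      (S : Fin 3 → Set X) (δ : Set X), IsGKTrisection X g k S → IsCurve S δ →
      (¬ ∃ e : Metric.closedBall (0 : EuclideanSpace ℝ (Fin 2)) 1 → X,
        Manifold.IsSmoothEmbedding (𝓡∂ 2) (𝓡 4) ∞ e ∧ range e ⊆ centralSurfaceSet S ∧
          e '' (𝓡∂ 2).boundary (Metric.closedBall (0 : EuclideanSpace ℝ (Fin 2)) 1) = δ) →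
      (∀ q : Fin 3, BoundsDisc S (spineHandlebody S q) δ) → IsNonSeparating S δ →
      ¬ SimplyConnectedSpace X)
    (hirr₀ : ∀ (X : Type) [TopologicalSpace X] [T2Space X] [SecondCountableTopology X]
      [ChartedSpace (EuclideanSpace ℝ (Fin 4)) X] [IsManifold (𝓡 4) ∞ X] [CompactSpace X]
      [ConnectedSpace X] (_ : SmoothOrientation (𝓡 4) X) (S : Fin 3 → Set X),
      IsBalancedGKTrisection X 3 1 S →
      (∃ c c' : Set X, IsCurve S c ∧ IsCurve S c' ∧ Disjoint c c' ∧
        IsNonSeparating S c ∧ IsNonSeparating S c' ∧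
        BoundsDisc S (spineHandlebody S 0) c ∧ BoundsDisc S (spineHandlebody S 1) c' ∧
        BoundsDisc S (spineHandlebody S 2) c') →
      ¬ IsReducible S → X ≃ₕ (Metric.sphere (0 : EuclideanSpace ℝ (Fin (4 + 1))) 1) →
        Nonempty (X ≃ₘ⟮𝓡 4, 𝓡 4⟯ (Metric.sphere (0 : EuclideanSpace ℝ (Fin (4 + 1))) 1))) :
    az2025_weaklyReducible_genusThree_homotopySphere_gk.{u} :=
  az2025_weaklyReducible_genusThree_homotopySphere_gk_of_msz_of_sep_of_pi1_of_irreducible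
    (msz_homotopySphere_gk_of_univ hMSZ₀) (isConnectedSum_of_reducing_separating_of_univ hsep₀)
    (fun X _ _ _ _ _ _ _ o g k S δ hT hc hess hd hn =>
      not_simplyConnectedSpace_of_reducing_nonseparating_of_univ hπ₀ X o g k S δ hT hc hess hd hn)
    (fun X _ _ _ _ _ _ _ o S hT hwr hnr e => az2025_irreducibleCore_of_univ hirr₀ X o S hT hwr hnr e)

end PiOneShadow

end Literature.Barriers.SmoothPoincare4

end
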